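import Summits.CriticalPhenomena.SAWScalingLimit.Theorems.SAWRenewalTightnessSubseqIdentificationLatticeRoomDataNRReduction
import Summits.CriticalPhenomena.SAWScalingLimit.Theorems.SAWRenewalTightnessSubseqIdentificationSawLatticeDriversStemCapacity
import Literature.Probability.RandomPlanarGeometry.LatticeSlitBoundaryTouching
import HarnessLib

/-!
# The near-past events of the guarded room data are eventually empty (given the degeneracy of
# pasts through the target point)

Crux `SubseqIdentification` (stmt-CriticalPhenomena-0783), line `room-entropy-wright-fisher`, stub
`stub_latticeRoomDataNR`; companion of `…LatticeRoomDataNRReduction.lean` (p120877), which reduces the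
guarded (H2) statement to `RoomLawSlit`, `RoomDeficitUI` and the smallness of three part events. This
file discharges the first of them, `nearPastEvent` (a past of positive capacity `≤ (Im w)²/16` comes
within `ρ` of `φ w`), from ONE deterministic input, the **degeneracy of pasts through the target**:
a past whose polyline passes through `b = D.pt 1 = φ(∞)` has capacity time `0` (its pulled-back trace
runs through `∞` and splits `ℍ`, so the fill has no hydrodynamic map; Newman's cross-cut theorem and
Carathéodory's boundary correspondence — taken here as a hypothesis). Given it, a past of POSITIVE
capacity avoids `b`, its hull is an honest bounded hull (`LatticeSlit.isBoundedHull_pastHull_of_notMem`,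
`LatticeSlitBoundaryTouching.lean`), and Kemppainen–Smirnov's height bound `(im)² ≤ 4 t_η ≤ (Im w)²/4`
keeps every vertex out of the ball around `φ w` that `φ⁻¹` lifts above height `Im w/2`
(`LatticeSlit.exists_radius_forall_le_dist_of_notMem`): the near-past event is EMPTY for small `δ`
(`δ a_δ ∈ D` eventually: `eventually_meshPoint_fst_mem`, p116522).

References: G. F. Lawler, *Conformally Invariant Processes in the Plane* (2005), §3.4, §4.1;
A. Kemppainen, S. Smirnov, Ann. Probab. 45 (2017), App. A, Lemma A.13.
-/

noncomputable section

open MeasureTheory Filter Topology Set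
open scoped NNReal ENNReal Classical BigOperators
open Literature.Probability.LatticeModels
open Literature.Probability.RandomPlanarGeometry
open UpperHalfPlane (upperHalfPlaneSet)

namespace Summit.CriticalPhenomena.SAWScalingLimit.Theorems.SubseqIdentification.RoomEntropy

/-- **The near-past events are eventually empty, given the degeneracy of pasts through the target.**
If pasts whose polyline passes through `b = D.pt 1` have capacity time `0` (hypothesis), then for
`w ∈ ℍ` there is `ρ > 0` such that for all small `δ` no past of positive capacity `≤ (Im w)²/16` of a
SAW from `a_δ` to `b_δ` has a vertex within `ρ` of `φ w`; in particular the near-past event has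
probability `≤ ε` for every `ε > 0`. [folklore] -/
theorem nearPastEvent_small_of_degenerate :
    (∀ (D : DobrushinDomain) (a b : ℝ → Site 2) (φ : ConformalEquiv upperHalfPlaneSet D.carrier),
      SAW.IsEndpointApprox D a b → D.IsChordalUniformizing φ → ∀ᶠ δ in 𝓝[>] (0 : ℝ),
        ∀ (γ : SAW.DomainSAW D.carrier δ (a δ) (b δ)) (n : ℕ),
          D.pt 1 ∈ Set.range ((prefixAt γ n).toCurve (meshPoint δ)) →
          LatticeSlit.capTime φ (prefixAt γ n) = 0) →
    ∀ (D : DobrushinDomain) (a b : ℝ → Site 2) (φ : ConformalEquiv upperHalfPlaneSet D.carrier),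
      SAW.IsEndpointApprox D a b → D.IsChordalUniformizing φ →
      ∀ w : ℂ, 0 < w.im → ∃ ρ : ℝ, 0 < ρ ∧ ∀ ε : ℝ, 0 < ε → ∀ᶠ δ in 𝓝[>] (0 : ℝ),
        SAW.law D.carrier δ (a δ) (b δ) (nearPastEvent D φ δ (a δ) (b δ) w ρ) ≤ ENNReal.ofReal ε := by
  intro hJ D a b φ hab hφ w hw
  obtain ⟨ρ, hρ, hfar⟩ := LatticeSlit.exists_radius_forall_le_dist_of_notMem φ hφ.2 hw
  refine ⟨ρ, hρ, fun ε _ ↦ ?_⟩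
  filter_upwards [hJ D a b φ hab hφ, eventually_meshPoint_fst_mem hab] with δ hδ h0
  have hempty : nearPastEvent D φ δ (a δ) (b δ) w ρ = ∅ := by
    refine eq_empty_of_forall_notMem fun γ ⟨n, hpos, hcap, v, hv, hlt⟩ ↦ ?_
    have hnb : D.pt 1 ∉ Set.range ((prefixAt γ n).toCurve (meshPoint δ)) := fun hmem ↦ by
      have := hδ γ n hmem
      linarith
    exact (not_le.2 hlt) (hfar (prefixAt γ n) h0 hnb hcap v hv)
  rw [hempty, measure_empty]
  exact bot_le

end Summit.CriticalPhenomena.SAWScalingLimit.Theorems.SubseqIdentification.RoomEntropy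

end
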